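import Summits.QuantumFields.YangMills.Theorems.FradkinShenkerFlowFiniteSusceptibilityWeakCouplingMirrorFunnel
import Summits.QuantumFields.YangMills.Theorems.FradkinShenkerFlowFiniteSusceptibilityWeakCouplingMirrorPositivity
import HarnessLib

/-!
# Step-one log-convexity of the mirror correlator on the odd torus (item stmt-QuantumFields-9442)

Support file for item stmt-QuantumFields-9442 (route `FradkinShenkerFlow` of `YangMills`), crux
`Summit.QuantumFields.YangMills.Theses.FradkinShenkerFlow.FiniteSusceptibilityWeakCoupling`, line `purity-rate-split`
(`Cruxes/FiniteSusceptibilityWeakCoupling/Lines/purity_rate_split.lean`): the reflection-positivity input of the theorem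
"crux ⇒ STUB 0" (`…MirrorMonotone.lean`). Everything holds for every compact `G` and every `β ≥ 0`.

Write `L = 2S+1`, `D_A(m) = ⟨A · τ_{m e₀}(A∘Θ)⟩_{β,L} − ⟨A⟩⟨A∘Θ⟩` (`latticeConnectedCorr … A.F (A.F ∘ cfgReflect) m`, `Θ = cfgReflect`)
and let `R` bound the time extent of `supp A` (`|t| + 2 ≤ R` for every link).

* `MirrorLogConvex.rp_three_lags_odd` / `rp_three_lags_even` — THREE-LAG CAUCHY–SCHWARZ: centred RP + Cauchy–Schwarz
  (`stub_rpCauchySchwarz stub_oddTorusRP`) in the plane `(1, 0)` for two time-translates (by `a, b ∈ [R+1, S−R]`) of the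
  mirror species `Aᴿ` gives `D_A(a+b−1)² ≤ D_A(2a−1)·D_A(2b−1)` with non-negative factors (link-plane reading of the
  reflection `θ t = 1 − t`); for two translates of `A` itself the same reflection, read through its antipodal SITE plane
  `t = S + 1` (periodicity of the lift), gives `D_A(L−(a+b−1))² ≤ D_A(L−(2a−1))·D_A(L−(2b−1))`;
* `MirrorLogConvex.mirrorCorr_nonneg`, `mirrorCorr_sq_le` (registered `stub_mirrorCorrLogConvex`) — hence `D_A ≥ 0` on
  `[2R+1, 2S−2R]` and `D_A` is LOG-CONVEX WITH STEP ONE on `[2R+2, 2S−2R−1]` (even lags from the link plane, odd lags from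
  the site plane: on the odd torus every reflection is both);
* `MirrorLogConvex.mirrorCorr_fold` — `D_A(j) = ⟨Aᴿ · τ_{(L−j)e₀} A⟩ − ⟨Aᴿ⟩⟨A⟩` (periodicity + translation invariance), and
  `mirrorCorr_reflSpecies` — the swapped correlator is the mirror correlator of `Aᴿ`.

No definition is introduced; nothing here is a named fact. Reference: K. Osterwalder, E. Seiler, Ann. Phys. 110 (1978)
440, §2 (reflection positivity of the Wilson action, here through the tree's odd-torus version). [folklore]
-/

noncomputable section

open MeasureTheory ProbabilityTheory Finset
open Literature.MathematicalPhysics.QuantumFieldTheory hiding Site ZdEdge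
open Literature.MathematicalPhysics.QuantumLattice
open Literature.Probability.LatticeModels hiding configShift configShift_apply

namespace Summit.QuantumFields.YangMills.Theorems.FiniteSusceptibilityWeakCoupling

namespace MirrorLogConvex

open MirrorDominationAxis0

/-! ## §1 Lattice identities: the mirror of the mirror, time radii, periodic lags, placed translates -/

section Lattice

variable {G : Type} [Group G] [TopologicalSpace G] [IsTopologicalGroup G] [CompactSpace G]
  [MeasurableSpace G] [BorelSpace G]

omit [CompactSpace G] in
/-- `(Aᴿ)ᴿ = A` as observables (`cfgReflect` is an involution). [folklore] -/
theorem reflSpecies_reflSpecies_F (A : YMSpecies G) (V : LGConfig 4 G) :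
    (reflSpecies (reflSpecies A)).F V = A.F V := by
  show A.F (cfgReflect (cfgReflect V)) = A.F V
  rw [cfgReflect_cfgReflect]

omit [CompactSpace G] in
/-- Time extent of the mirror species: if every link of `supp A` has time coordinate `t` with `|t| + (k+1) ≤ R`, every
link of `supp Aᴿ` (time coordinate `-t` or `-t-1`) has `|t'| + k ≤ R`. [folklore] -/
theorem radius_reflSpecies (A : YMSpecies G) {R k : ℕ} (hR : ∀ e ∈ A.supp, (e.1 0).natAbs + (k + 1) ≤ R) :
    ∀ e ∈ (reflSpecies A).supp, (e.1 0).natAbs + k ≤ R := by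
  intro e he
  obtain ⟨e', he', rfl⟩ := Finset.mem_image.1 he
  have h := hR e' he'
  rw [reflectEdge_fst_zero]
  split_ifs <;> omega

omit [Group G] [TopologicalSpace G] [IsTopologicalGroup G] [CompactSpace G] [BorelSpace G] in
/-- **Periodicity of the lag**: on the torus of side `L`, translating the lifted configuration by `+j e₀` is translating
it by `-n e₀` when `j + n = L`. [folklore] -/
theorem configShift_single_period {L j n : ℕ} (h : j + n = L) (U : GaugeConfig 4 L G) :
    configShift (Pi.single 0 (j : ℤ)) (torusLift L U) = configShift (-(Pi.single 0 (n : ℤ))) (torusLift L U) := by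
  have hsum : (Pi.single 0 (j : ℤ) : Site 4) = -(Pi.single 0 (n : ℤ)) + Pi.single 0 (L : ℤ) := by
    funext k
    rcases eq_or_ne k 0 with rfl | hk
    · simp only [Pi.single_eq_same, Pi.add_apply, Pi.neg_apply]; omega
    · simp [hk]
  rw [hsum, ← configShift_configShift, configShift_torusLift_of_proj_eq_zero L (proj_single_self L)]

omit [TopologicalSpace G] [IsTopologicalGroup G] [CompactSpace G] [BorelSpace G] in
/-- **Placement in the positive half.** A translate by `a e₀` of an observable whose links have time coordinates
`|t| + 1 ≤ R` lives, for `R + 1 ≤ a` and `a + R ≤ S`, on links of the torus `(ℤ/(2S+1))⁴` with time coordinate in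
`[1, S]`: the positive half for the reflection through the link plane `t = ½` (plane `(1, 0)`). [folklore] -/
theorem dependsOn_shift_pos (B : YMSpecies G) {R : ℕ} (hR : ∀ e ∈ B.supp, (e.1 0).natAbs + 1 ≤ R) {S a : ℕ}
    (ha : R + 1 ≤ a) (haS : a + R ≤ S) :
    DependsOn (fun U : GaugeConfig 4 (2 * S + 1) G =>
        B.F (configShift (-(Pi.single 0 (a : ℤ))) (torusLift (2 * S + 1) U)))
      {e : Edge 4 (2 * S + 1) |
        WilsonOddRP.IsOPosEdge (sitePerm (1 : Equiv.Perm (Fin 4)).symm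
          (e.1 - Torus.proj (2 * S + 1) (Pi.single 0 ((0 : ℕ) : ℤ))), (1 : Equiv.Perm (Fin 4)).symm e.2) ∨
        WilsonOddRP.IsOSharedEdge (sitePerm (1 : Equiv.Perm (Fin 4)).symm
          (e.1 - Torus.proj (2 * S + 1) (Pi.single 0 ((0 : ℕ) : ℤ))), (1 : Equiv.Perm (Fin 4)).symm e.2)} := by
  refine (Negative.dependsOn_comp_configShift_torusLift (2 * S + 1) B _).mono ?_
  intro e he
  obtain ⟨e', he', rfl⟩ := Finset.mem_image.1 (Finset.mem_coe.1 he)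
  have ht := hR e' he'
  have h0 : (e'.1 + (Pi.single 0 (a : ℤ) : Site 4)) 0 = e'.1 0 + a := by
    rw [Pi.add_apply, Pi.single_eq_same]
  refine torusEdge_mem_pos S 0 _ _ ?_ ?_ <;> rw [h0] <;> push_cast <;> omega

variable {N : ℕ} (ρ : G →* Matrix (Fin N) (Fin N) ℂ) (β : ℝ)

/-- The vector identity behind the link-plane reading: `-(b e₀) + (1 - a) e₀ = -(n e₀)` for `n + 1 = a + b`.
[folklore] -/
theorem neg_single_add_single {a b n : ℕ} (hn : n + 1 = a + b) :
    -(Pi.single 0 (b : ℤ) : Site 4) + Pi.single 0 (1 - (a : ℤ)) = -(Pi.single 0 (n : ℤ)) := by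
  funext k
  rcases eq_or_ne k 0 with rfl | hk
  · simp only [Pi.single_eq_same, Pi.add_apply, Pi.neg_apply]; omega
  · simp [hk]

/-- **Link-plane reading of a reflected pair**: `Cov(P∘τ_{-(1-a)e₀}∘lift, Q∘τ_{-b e₀}∘lift) = Cov(P∘lift, Q∘τ_{-n e₀}∘lift)`
for `n + 1 = a + b` (translation invariance). [folklore] -/
theorem cov_pair_link {L : ℕ} [NeZero L] (P Q : LGConfig 4 G → ℝ) {a b n : ℕ} (hn : n + 1 = a + b) :
    cov[fun U => P (configShift (-(Pi.single 0 (1 - (a : ℤ)))) (torusLift L U)),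
        fun U => Q (configShift (-(Pi.single 0 (b : ℤ))) (torusLift L U)); wilsonMeasure (d := 4) (L := L) ρ β] =
      cov[fun U => P (torusLift L U), fun U => Q (configShift (-(Pi.single 0 (n : ℤ))) (torusLift L U));
        wilsonMeasure (d := 4) (L := L) ρ β] :=
  cov_translate_left ρ β P Q (neg_single_add_single hn)

/-- **Site-plane (antipodal) reading of a reflected pair**: on the torus of side `L`,
`Cov(Q∘τ_{-(1-a)e₀}∘lift, P∘τ_{-b e₀}∘lift) = Cov(P∘lift, Q∘τ_{-n e₀}∘lift)` for `(a + b - 1) + n = L`, `1 ≤ a + b`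
(symmetry of the covariance, translation invariance, periodicity of the lift). [folklore] -/
theorem cov_pair_site {L : ℕ} [NeZero L] (P Q : LGConfig 4 G → ℝ) {a b n : ℕ} (hab : 1 ≤ a + b)
    (hn : (a + b - 1) + n = L) :
    cov[fun U => Q (configShift (-(Pi.single 0 (1 - (a : ℤ)))) (torusLift L U)),
        fun U => P (configShift (-(Pi.single 0 (b : ℤ))) (torusLift L U)); wilsonMeasure (d := 4) (L := L) ρ β] =
      cov[fun U => P (torusLift L U), fun U => Q (configShift (-(Pi.single 0 (n : ℤ))) (torusLift L U));
        wilsonMeasure (d := 4) (L := L) ρ β] := by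
  have hvec : -(Pi.single 0 (1 - (a : ℤ)) : Site 4) + Pi.single 0 (b : ℤ) = Pi.single 0 ((a + b - 1 : ℕ) : ℤ) := by
    funext k
    rcases eq_or_ne k 0 with rfl | hk
    · simp only [Pi.single_eq_same, Pi.add_apply, Pi.neg_apply]; omega
    · simp [hk]
  rw [covariance_comm, cov_translate_left ρ β P Q hvec]
  simp only [configShift_single_period hn]

end Lattice

/-! ## §2 Three-lag Cauchy–Schwarz on the odd torus -/

section ThreeLags

variable {G : Type} [Group G] [TopologicalSpace G] [IsTopologicalGroup G] [CompactSpace G]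
  [MeasurableSpace G] [BorelSpace G]

/-- **Three-lag Cauchy–Schwarz, link-plane reading** (every compact `G`, every `β ≥ 0`). For a species `A` whose links
have time coordinates `|t| + 2 ≤ R` and translates `a, b ∈ [R+1, S−R]`, the mirror correlator
`D_A(m) = ⟨A · τ_m (A∘Θ)⟩ − ⟨A⟩⟨A∘Θ⟩` on the torus `2S+1` satisfies `0 ≤ D_A(2a−1)`, `0 ≤ D_A(2b−1)` and
`D_A(a+b−1)² ≤ D_A(2a−1) · D_A(2b−1)`: centred RP + Cauchy–Schwarz (`stub_rpCauchySchwarz stub_oddTorusRP`, plane `(1,0)`)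
for `F = Aᴿ∘τ_{-a e₀}∘lift`, `G' = Aᴿ∘τ_{-b e₀}∘lift`, whose reflections are `A∘τ_{-(1-a)e₀}∘lift`, `A∘τ_{-(1-b)e₀}∘lift`
(`torusLift_theta`, `(Aᴿ)ᴿ = A`). [folklore] -/
theorem rp_three_lags_odd (r : LatticeRep G) {β : ℝ} (hβ : 0 ≤ β) (A : YMSpecies G) {R : ℕ}
    (hR : ∀ e ∈ A.supp, (e.1 0).natAbs + 2 ≤ R) {S a b : ℕ} (ha : R + 1 ≤ a) (haS : a + R ≤ S)
    (hb : R + 1 ≤ b) (hbS : b + R ≤ S) :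
    0 ≤ latticeConnectedCorr r.ρ β (2 * S + 1) A.F (fun V => A.F (cfgReflect V)) (2 * a - 1) ∧
    0 ≤ latticeConnectedCorr r.ρ β (2 * S + 1) A.F (fun V => A.F (cfgReflect V)) (2 * b - 1) ∧
    latticeConnectedCorr r.ρ β (2 * S + 1) A.F (fun V => A.F (cfgReflect V)) (a + b - 1) ^ 2 ≤
      latticeConnectedCorr r.ρ β (2 * S + 1) A.F (fun V => A.F (cfgReflect V)) (2 * a - 1) *
        latticeConnectedCorr r.ρ β (2 * S + 1) A.F (fun V => A.F (cfgReflect V)) (2 * b - 1) := by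
  haveI : IsProbabilityMeasure (wilsonMeasure (d := 4) (L := 2 * S + 1) r.ρ β) :=
    isProbabilityMeasure_wilsonMeasure _ r.continuous β
  have hR' : ∀ e ∈ (reflSpecies A).supp, (e.1 0).natAbs + 1 ≤ R := radius_reflSpecies A (k := 1) hR
  obtain ⟨hD₁, hD₂, hcs⟩ := stub_rpCauchySchwarz stub_oddTorusRP G r.N r.ρ r.continuous β hβ S (by omega) 1
    (Torus.proj (2 * S + 1) (Pi.single 0 ((0 : ℕ) : ℤ)))
    (fun U => (reflSpecies A).F (configShift (-(Pi.single 0 (a : ℤ))) (torusLift (2 * S + 1) U)))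
    (fun U => (reflSpecies A).F (configShift (-(Pi.single 0 (b : ℤ))) (torusLift (2 * S + 1) U)))
    ((reflSpecies A).measurable.comp ((configShift _).measurable.comp (measurable_torusLift _)))
    ((reflSpecies A).measurable.comp ((configShift _).measurable.comp (measurable_torusLift _)))
    (by obtain ⟨C, hC⟩ := (reflSpecies A).bounded; exact ⟨C, fun U => hC _⟩)
    (by obtain ⟨C, hC⟩ := (reflSpecies A).bounded; exact ⟨C, fun U => hC _⟩)
    (dependsOn_shift_pos (reflSpecies A) hR' ha haS) (dependsOn_shift_pos (reflSpecies A) hR' hb hbS)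
  -- `F∘Θ = A∘τ_{-(1-a)e₀}∘lift`, `G'∘Θ = A∘τ_{-(1-b)e₀}∘lift`
  have hv : ∀ c : ℕ, -(siteReflect (Pi.single 0 (c : ℤ) : Site 4) + Pi.single 0 ((2 * 0 + 1 : ℕ) : ℤ)) =
      -(Pi.single 0 (1 - (c : ℤ))) := fun c => by
    funext k
    rcases eq_or_ne k 0 with rfl | hk
    · simp only [Pi.neg_apply, Pi.add_apply, siteReflect_apply, Pi.single_eq_same, if_true]; push_cast; ring
    · simp [siteReflect_apply, hk]
  simp only [torusLift_theta, F_shift_cfgReflect_shift, reflSpecies_reflSpecies_F, hv] at hD₁ hD₂ hcs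
  rw [cov_pair_link r.ρ β A.F (reflSpecies A).F (show (2 * a - 1) + 1 = a + a by omega),
    SiblingFunnel.covariance_eq_latticeConnectedCorr r β A (reflSpecies A) S] at hD₁
  rw [cov_pair_link r.ρ β A.F (reflSpecies A).F (show (2 * b - 1) + 1 = b + b by omega),
    SiblingFunnel.covariance_eq_latticeConnectedCorr r β A (reflSpecies A) S] at hD₂
  rw [cov_pair_link r.ρ β A.F (reflSpecies A).F (show (a + b - 1) + 1 = a + b by omega),
    cov_pair_link r.ρ β A.F (reflSpecies A).F (show (2 * a - 1) + 1 = a + a by omega),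
    cov_pair_link r.ρ β A.F (reflSpecies A).F (show (2 * b - 1) + 1 = b + b by omega),
    SiblingFunnel.covariance_eq_latticeConnectedCorr r β A (reflSpecies A) S,
    SiblingFunnel.covariance_eq_latticeConnectedCorr r β A (reflSpecies A) S,
    SiblingFunnel.covariance_eq_latticeConnectedCorr r β A (reflSpecies A) S] at hcs
  exact ⟨hD₁, hD₂, hcs⟩

/-- **Three-lag Cauchy–Schwarz, site-plane reading** (every compact `G`, every `β ≥ 0`). Same hypotheses; now
`F = A∘τ_{-a e₀}∘lift`, `G' = A∘τ_{-b e₀}∘lift`, whose reflections `Aᴿ∘τ_{-(1-a)e₀}∘lift`, `Aᴿ∘τ_{-(1-b)e₀}∘lift` sit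
at NEGATIVE lags; read through the antipodal site plane `t = S + 1` (periodicity of the lift), the three covariances
are `D_A` at the lags `2S+2−2a`, `2S+2−2b`, `2S+2−a−b`: `0 ≤ D_A(2S+2−2a)`, `0 ≤ D_A(2S+2−2b)`,
`D_A(2S+2−a−b)² ≤ D_A(2S+2−2a) · D_A(2S+2−2b)`. [folklore] -/
theorem rp_three_lags_even (r : LatticeRep G) {β : ℝ} (hβ : 0 ≤ β) (A : YMSpecies G) {R : ℕ}
    (hR : ∀ e ∈ A.supp, (e.1 0).natAbs + 2 ≤ R) {S a b : ℕ} (ha : R + 1 ≤ a) (haS : a + R ≤ S)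
    (hb : R + 1 ≤ b) (hbS : b + R ≤ S) :
    0 ≤ latticeConnectedCorr r.ρ β (2 * S + 1) A.F (fun V => A.F (cfgReflect V)) (2 * S + 2 - 2 * a) ∧
    0 ≤ latticeConnectedCorr r.ρ β (2 * S + 1) A.F (fun V => A.F (cfgReflect V)) (2 * S + 2 - 2 * b) ∧
    latticeConnectedCorr r.ρ β (2 * S + 1) A.F (fun V => A.F (cfgReflect V)) (2 * S + 2 - a - b) ^ 2 ≤
      latticeConnectedCorr r.ρ β (2 * S + 1) A.F (fun V => A.F (cfgReflect V)) (2 * S + 2 - 2 * a) *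
        latticeConnectedCorr r.ρ β (2 * S + 1) A.F (fun V => A.F (cfgReflect V)) (2 * S + 2 - 2 * b) := by
  haveI : IsProbabilityMeasure (wilsonMeasure (d := 4) (L := 2 * S + 1) r.ρ β) :=
    isProbabilityMeasure_wilsonMeasure _ r.continuous β
  have hR₁ : ∀ e ∈ A.supp, (e.1 0).natAbs + 1 ≤ R := fun e he => by have := hR e he; omega
  obtain ⟨hD₁, hD₂, hcs⟩ := stub_rpCauchySchwarz stub_oddTorusRP G r.N r.ρ r.continuous β hβ S (by omega) 1
    (Torus.proj (2 * S + 1) (Pi.single 0 ((0 : ℕ) : ℤ)))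
    (fun U => A.F (configShift (-(Pi.single 0 (a : ℤ))) (torusLift (2 * S + 1) U)))
    (fun U => A.F (configShift (-(Pi.single 0 (b : ℤ))) (torusLift (2 * S + 1) U)))
    (A.measurable.comp ((configShift _).measurable.comp (measurable_torusLift _)))
    (A.measurable.comp ((configShift _).measurable.comp (measurable_torusLift _)))
    (by obtain ⟨C, hC⟩ := A.bounded; exact ⟨C, fun U => hC _⟩)
    (by obtain ⟨C, hC⟩ := A.bounded; exact ⟨C, fun U => hC _⟩)
    (dependsOn_shift_pos A hR₁ ha haS) (dependsOn_shift_pos A hR₁ hb hbS)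
  have hv : ∀ c : ℕ, -(siteReflect (Pi.single 0 (c : ℤ) : Site 4) + Pi.single 0 ((2 * 0 + 1 : ℕ) : ℤ)) =
      -(Pi.single 0 (1 - (c : ℤ))) := fun c => by
    funext k
    rcases eq_or_ne k 0 with rfl | hk
    · simp only [Pi.neg_apply, Pi.add_apply, siteReflect_apply, Pi.single_eq_same, if_true]; push_cast; ring
    · simp [siteReflect_apply, hk]
  simp only [torusLift_theta, F_shift_cfgReflect_shift, hv] at hD₁ hD₂ hcs
  rw [cov_pair_site r.ρ β A.F (reflSpecies A).F (show 1 ≤ a + a by omega)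
      (show (a + a - 1) + (2 * S + 2 - 2 * a) = 2 * S + 1 by omega),
    SiblingFunnel.covariance_eq_latticeConnectedCorr r β A (reflSpecies A) S] at hD₁
  rw [cov_pair_site r.ρ β A.F (reflSpecies A).F (show 1 ≤ b + b by omega)
      (show (b + b - 1) + (2 * S + 2 - 2 * b) = 2 * S + 1 by omega),
    SiblingFunnel.covariance_eq_latticeConnectedCorr r β A (reflSpecies A) S] at hD₂
  rw [cov_pair_site r.ρ β A.F (reflSpecies A).F (show 1 ≤ a + b by omega)
      (show (a + b - 1) + (2 * S + 2 - a - b) = 2 * S + 1 by omega),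
    cov_pair_site r.ρ β A.F (reflSpecies A).F (show 1 ≤ a + a by omega)
      (show (a + a - 1) + (2 * S + 2 - 2 * a) = 2 * S + 1 by omega),
    cov_pair_site r.ρ β A.F (reflSpecies A).F (show 1 ≤ b + b by omega)
      (show (b + b - 1) + (2 * S + 2 - 2 * b) = 2 * S + 1 by omega),
    SiblingFunnel.covariance_eq_latticeConnectedCorr r β A (reflSpecies A) S,
    SiblingFunnel.covariance_eq_latticeConnectedCorr r β A (reflSpecies A) S,
    SiblingFunnel.covariance_eq_latticeConnectedCorr r β A (reflSpecies A) S] at hcs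
  exact ⟨hD₁, hD₂, hcs⟩

end ThreeLags

/-! ## §3 Positivity, step-one log-convexity and the periodic fold of the mirror correlator -/

section Consequences

variable {G : Type} [Group G] [TopologicalSpace G] [IsTopologicalGroup G] [CompactSpace G]
  [MeasurableSpace G] [BorelSpace G]

/-- **The mirror correlator is non-negative on `[2R+1, 2S−2R]`** (every compact `G`, `β ≥ 0`): odd lags `2a−1` from the
link plane, even lags `2S+2−2a` from the site plane (`rp_three_lags_odd/even` with `a = b`). This extends the landed
`MirrorPositivity.mirrorCorr_nonneg_eventually` (lags `≤ S`) to the lags `S < m ≤ 2S − 2R`. [folklore] -/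
theorem mirrorCorr_nonneg (r : LatticeRep G) {β : ℝ} (hβ : 0 ≤ β) (A : YMSpecies G) {R : ℕ}
    (hR : ∀ e ∈ A.supp, (e.1 0).natAbs + 2 ≤ R) {S m : ℕ} (hm : 2 * R + 1 ≤ m) (hmS : m + 2 * R ≤ 2 * S) :
    0 ≤ latticeConnectedCorr r.ρ β (2 * S + 1) A.F (fun V => A.F (cfgReflect V)) m := by
  obtain ⟨q, rfl | rfl⟩ := Nat.even_or_odd' m
  · obtain ⟨h1, -, -⟩ := rp_three_lags_even r hβ A hR (S := S) (a := S + 1 - q) (b := S + 1 - q)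
      (by omega) (by omega) (by omega) (by omega)
    rwa [show 2 * S + 2 - 2 * (S + 1 - q) = 2 * q by omega] at h1
  · obtain ⟨h1, -, -⟩ := rp_three_lags_odd r hβ A hR (S := S) (a := q + 1) (b := q + 1)
      (by omega) (by omega) (by omega) (by omega)
    rwa [show 2 * (q + 1) - 1 = 2 * q + 1 by omega] at h1

/-- **The mirror correlator is log-convex with step one on `[2R+2, 2S−2R−1]`** (every compact `G`, `β ≥ 0`):
`D_A(m)² ≤ D_A(m−1) · D_A(m+1)` — even `m = 2q` from the link plane (`a = q`, `b = q+1`), odd `m = 2q+1` from the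
site plane (`a = S+1−q`, `b = S−q`). On the odd torus every reflection is a link-plane AND a site-plane reflection,
which is what makes the step ONE rather than two. [folklore] -/
theorem mirrorCorr_sq_le (r : LatticeRep G) {β : ℝ} (hβ : 0 ≤ β) (A : YMSpecies G) {R : ℕ}
    (hR : ∀ e ∈ A.supp, (e.1 0).natAbs + 2 ≤ R) {S m : ℕ} (hm : 2 * R + 2 ≤ m) (hmS : m + 2 * R + 1 ≤ 2 * S) :
    latticeConnectedCorr r.ρ β (2 * S + 1) A.F (fun V => A.F (cfgReflect V)) m ^ 2 ≤
      latticeConnectedCorr r.ρ β (2 * S + 1) A.F (fun V => A.F (cfgReflect V)) (m - 1) *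
        latticeConnectedCorr r.ρ β (2 * S + 1) A.F (fun V => A.F (cfgReflect V)) (m + 1) := by
  obtain ⟨q, rfl | rfl⟩ := Nat.even_or_odd' m
  · obtain ⟨-, -, h⟩ := rp_three_lags_odd r hβ A hR (S := S) (a := q) (b := q + 1)
      (by omega) (by omega) (by omega) (by omega)
    rwa [show q + (q + 1) - 1 = 2 * q by omega, show 2 * (q + 1) - 1 = 2 * q + 1 by omega] at h
  · obtain ⟨-, -, h⟩ := rp_three_lags_even r hβ A hR (S := S) (a := S + 1 - q) (b := S - q)
      (by omega) (by omega) (by omega) (by omega)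
    rwa [show 2 * S + 2 - (S + 1 - q) - (S - q) = 2 * q + 1 by omega,
      show 2 * S + 2 - 2 * (S + 1 - q) = 2 * q + 1 - 1 by omega,
      show 2 * S + 2 - 2 * (S - q) = 2 * q + 1 + 1 by omega] at h

/-- **Periodic fold** (every `β`): `D_A(j) = ⟨Aᴿ · τ_{(L−j)e₀} A⟩ − ⟨Aᴿ⟩⟨A⟩` for `j ≤ L = 2S+1` (periodicity of the lift,
translation invariance, symmetry of the covariance: `MirrorDominationAxis0.cov_fold`; the landed
`MirrorPositivity.mirrorCorr_evenLag_eq_fold` is the case of even `j`). [folklore] -/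
theorem mirrorCorr_fold (r : LatticeRep G) (β : ℝ) (A : YMSpecies G) {S j : ℕ} (hj : j ≤ 2 * S + 1) :
    latticeConnectedCorr r.ρ β (2 * S + 1) A.F (fun V => A.F (cfgReflect V)) j =
      latticeConnectedCorr r.ρ β (2 * S + 1) (fun V => A.F (cfgReflect V)) A.F (2 * S + 1 - j) := by
  have e1 : cov[fun U => A.F (torusLift (2 * S + 1) U),
      fun U => A.F (cfgReflect (configShift (-(Pi.single 0 (j : ℤ))) (torusLift (2 * S + 1) U)));
      wilsonMeasure (d := 4) (L := 2 * S + 1) r.ρ β] =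
      latticeConnectedCorr r.ρ β (2 * S + 1) A.F (fun V => A.F (cfgReflect V)) j :=
    SiblingFunnel.covariance_eq_latticeConnectedCorr r β A (reflSpecies A) S j
  have e2 : cov[fun U => A.F (cfgReflect (torusLift (2 * S + 1) U)),
      fun U => A.F (configShift (-(Pi.single 0 ((2 * S + 1 - j : ℕ) : ℤ))) (torusLift (2 * S + 1) U));
      wilsonMeasure (d := 4) (L := 2 * S + 1) r.ρ β] =
      latticeConnectedCorr r.ρ β (2 * S + 1) (fun V => A.F (cfgReflect V)) A.F (2 * S + 1 - j) :=
    SiblingFunnel.covariance_eq_latticeConnectedCorr r β (reflSpecies A) A S (2 * S + 1 - j)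
  rw [← e1, ← e2]
  exact cov_fold r.ρ β A.F (reflSpecies A).F hj

/-- The fold read backwards: `D_A(L − m) = ⟨Aᴿ · τ_{m e₀} A⟩ − ⟨Aᴿ⟩⟨A⟩` for `m ≤ L`. [folklore] -/
theorem mirrorCorr_fold' (r : LatticeRep G) (β : ℝ) (A : YMSpecies G) {S m : ℕ} (hm : m ≤ 2 * S + 1) :
    latticeConnectedCorr r.ρ β (2 * S + 1) A.F (fun V => A.F (cfgReflect V)) (2 * S + 1 - m) =
      latticeConnectedCorr r.ρ β (2 * S + 1) (fun V => A.F (cfgReflect V)) A.F m := by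
  rw [mirrorCorr_fold r β A (show 2 * S + 1 - m ≤ 2 * S + 1 by omega),
    show 2 * S + 1 - (2 * S + 1 - m) = m by omega]

/-- The swapped correlator `⟨Aᴿ · τ_m A⟩ − ⟨Aᴿ⟩⟨A⟩` IS the mirror correlator of the mirror species `Aᴿ`
(`(Aᴿ)ᴿ = A`). [folklore] -/
theorem mirrorCorr_reflSpecies (r : LatticeRep G) (β : ℝ) (A : YMSpecies G) (S m : ℕ) :
    latticeConnectedCorr r.ρ β (2 * S + 1) (reflSpecies A).F (fun V => (reflSpecies A).F (cfgReflect V)) m =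
      latticeConnectedCorr r.ρ β (2 * S + 1) (fun V => A.F (cfgReflect V)) A.F m := by
  have h1 : (fun V => (reflSpecies A).F (cfgReflect V)) = A.F :=
    funext fun V => reflSpecies_reflSpecies_F A V
  rw [h1]
  rfl

end Consequences

end MirrorLogConvex

/-- **Registered sub-goal `stub_mirrorCorrLogConvex`** of item stmt-QuantumFields-9442 (signature verbatim, fully
qualified): at every `β ≥ 0`, for every compact `G`, every lattice representation and every gauge-invariant local
observable `A` with time extent `R`, the mirror correlator `m ↦ ⟨A · τ_{m e₀}(A∘Θ)⟩_{β,2S+1} − ⟨A⟩⟨A∘Θ⟩` is log-convex with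
step one on `2R+2 ≤ m ≤ 2S−2R−1` — the reflection-positivity input of "crux ⇒ STUB 0" for line `purity-rate-split`.
[folklore] -/
theorem stub_mirrorCorrLogConvex : ∀ (G : Type) [Group G] [TopologicalSpace G] [IsTopologicalGroup G] [CompactSpace G] [MeasurableSpace G] [BorelSpace G] (r : Literature.MathematicalPhysics.QuantumFieldTheory.LatticeRep G) (β : ℝ), 0 ≤ β → ∀ (A : Literature.MathematicalPhysics.QuantumFieldTheory.YMSpecies G) (R : ℕ), (∀ e ∈ A.supp, (e.1 0).natAbs + 2 ≤ R) → ∀ S m : ℕ, 2 * R + 2 ≤ m → m + 2 * R + 1 ≤ 2 * S → Literature.MathematicalPhysics.QuantumFieldTheory.latticeConnectedCorr r.ρ β (2 * S + 1) A.F (fun V => A.F (Literature.MathematicalPhysics.QuantumFieldTheory.cfgReflect V)) m ^ 2 ≤ Literature.MathematicalPhysics.QuantumFieldTheory.latticeConnectedCorr r.ρ β (2 * S + 1) A.F (fun V => A.F (Literature.MathematicalPhysics.QuantumFieldTheory.cfgReflect V)) (m - 1) * Literature.MathematicalPhysics.QuantumFieldTheory.latticeConnectedCorr r.ρ β (2 *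 S + 1) A.F (fun V => A.F (Literature.MathematicalPhysics.QuantumFieldTheory.cfgReflect V)) (m + 1) :=
  fun _G _ _ _ _ _ _ r _β hβ A _R hR _S _m hm hmS => MirrorLogConvex.mirrorCorr_sq_le r hβ A hR hm hmS

end Summit.QuantumFields.YangMills.Theorems.FiniteSusceptibilityWeakCoupling

end
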